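import Mathlib
import Literature.AlgebraicGeometry.Resolution.AffineBlowup
import Literature.AlgebraicGeometry.Resolution.AffineBlowupCartier
import Literature.AlgebraicGeometry.Resolution.AffineBlowupRegular
import Literature.AlgebraicGeometry.Resolution.BlowupPrincipalCharts
import Summits.ResolutionOfSingularities.ResolutionOfSingularities.Theorems.WildQuotientsWildQuotientResolutionJordanFourTwistedChartDefs
import Summits.ResolutionOfSingularities.ResolutionOfSingularities.Theorems.WildQuotientsWildQuotientResolutionJordanFourChartWDefs
import Summits.ResolutionOfSingularities.ResolutionOfSingularities.Theorems.WildQuotientsWildQuotientResolutionToricExitJordanThreeBrickNonempty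

/-!
# V4U bricks `HC₀W` / `HC₁W`: the vertex curves `C₀`, `C₁` against the twisted chart `W_T`

(crux stmt-ResolutionOfSingularities-15640 `WildQuotients.WildQuotientResolution`, line `Sketch`,
sector `|G| = p`; programme V4U of `L/w45c/CHAIN.md` v7.4 §4, RULING v7.4 (2) / GO of
res-L1-w45c-plan-1 2026-08-27T06:08:48Z/06:21:55Z to res-type-029; [OURS · L1 W4.5c] — NOT a
statement of any manuscript; replaces the role of no printed item.)

Two hypotheses of lead-1's scaffold `JordanFour.jordanFour_hasResolution_of_bricks` (p501160),
with binder types copied literally and `W := JordanFour.chartW k n a b c d` (stub-5, p504103: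
`chartW = D₊(T′t · H′³t²) = D₊(T′t) ⊓ D₊(H′³t²) ⊆ V = Bl_{I₆} 𝔸ⁿ = Proj R[I₆t]`,
`I₆ = (g₀,…,g₇) = (x_a², x_ax_b², x_ax_bx_c, x_ax_c³, x_b³, x_b²x_c², x_bx_c⁴, x_c⁶)`):

* `disjoint_curveZero_chartW` (**HC₀W**): `C₀ ∩ W_T = ∅` for
  `C₀ = π⁻¹V(x_a,x_b,x_c) ∖ ⋃_{j ≠ 0} V[⊤, g_j]`;
* `curveOne_subset_chartW` (**HC₁W**): `C₁ ⊆ W_T` for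
  `C₁ = π⁻¹V(x_a,x_b,x_c) ∖ ⋃_{j ≠ 4} V[⊤, g_j]`.

Both are Rees-monomial bookkeeping at the homogeneous prime `𝔭_v` of a point `v` of `Proj R[I₆t]`
and do not use `v ∈ π⁻¹V(x_a,x_b,x_c)`: since `D₊(g_j t) ⊆ V[⊤, g_j]`
(`BlowupExit.affineBlowup_chartOpen_le_blowupChart`, p498242), `v ∉ V[⊤, g_j]` gives `g_j t ∈ 𝔭_v`.
In `R[I₆t]` one has (`reesT_eq_of_eq_tPrime`, `eq_of_coe_eq_monomial_hPrime_cube`, stated over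
any commutative ring and any ideal containing the six generators involved)
`T′t = g₄t − 3·g₂t + (3x_d − x_b)·g₀t` and
`H′³t² = g₄t·(g₄t − 3·g₁t − 6·g₂t + (3x_b + 12x_c)·g₀t)`
`      + g₀t·(12·g₅t − (x_b + 6x_c)·g₁t − 12x_c·g₂t − 8·g₃t)`
(the expansion of `H′³ = (x_b² − x_ax_b − 2x_ax_c)³`, every monomial factored through two
generators). Hence off the charts `j ≠ 0` (`g₁t,…,g₅t ∈ 𝔭_v`) `H′³t² ∈ 𝔭_v`, so
`v ∉ D₊(H′³t²) ⊇ W_T` (**HC₀W**); off the charts `j ≠ 4` the `D₊(g_jt)` cover of `Proj` forces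
`g₄t ∉ 𝔭_v`, and then `T′t ≡ g₄t`, `H′³t² ≡ g₄t·(g₄t + 𝔭_v)` are not in the prime `𝔭_v`, so
`v ∈ D₊(T′t·H′³t²) = W_T` (**HC₁W**).
-/

-- single-problem summit: the doubled namespace component `ResolutionOfSingularities` is forced
set_option linter.dupNamespace false

noncomputable section

open MvPolynomial Polynomial AlgebraicGeometry TopologicalSpace
open Literature.AlgebraicGeometry.Resolution

namespace Summit.ResolutionOfSingularities.ResolutionOfSingularities.Theorems.WildQuotientResolution.JordanFour

/-! ### Generic Rees-algebra identities and memberships (any commutative ring, any ideal `I`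
containing the six relevant generators of `I₆`) -/

section ReesCores

variable {R : Type*} [CommRing R] {I : Ideal R} (xa xb xc xd : R)
  (h0 : xa ^ 2 ∈ I) (h1 : xa * xb ^ 2 ∈ I) (h2 : xa * xb * xc ∈ I) (h3 : xa * xc ^ 3 ∈ I)
  (h4 : xb ^ 3 ∈ I) (h5 : xb ^ 2 * xc ^ 2 ∈ I)

/-- **`T′ t = x_b³t − 3·(x_a x_b x_c)t + (3x_d − x_b)·(x_a²t)`** in the Rees algebra `R[It]`, for
`T′ = x_b³ − 3x_a x_b x_c + 3x_a² x_d − x_a² x_b`. [folklore] -/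
theorem reesT_eq_of_eq_tPrime (T : R)
    (hTdef : T = xb ^ 3 - 3 * (xa * xb * xc) + 3 * (xa ^ 2 * xd) - xa ^ 2 * xb) (hT : T ∈ I) :
    reesT T hT = reesT (xb ^ 3) h4 + (-3 : R) • reesT (xa * xb * xc) h2 +
      (3 * xd - xb) • reesT (xa ^ 2) h0 := by
  apply Subtype.ext
  simp only [Subalgebra.coe_add, Subalgebra.coe_smul, coe_reesT, Polynomial.smul_monomial,
    smul_eq_mul]
  apply Polynomial.ext
  intro m
  simp only [Polynomial.coeff_add, Polynomial.coeff_monomial]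
  split_ifs
  · rw [hTdef]; ring
  · ring

/-- **`H′³ t² = (x_b³t)·A♯ + (x_a²t)·B♯`** in the Rees algebra `R[It]` for
`H′ = x_b² − x_a x_b − 2x_a x_c`, with
`A♯ = x_b³t − 3·(x_a x_b²)t − 6·(x_a x_b x_c)t + (3x_b + 12x_c)·(x_a²t)` and
`B♯ = 12·(x_b²x_c²)t − (x_b + 6x_c)·(x_a x_b²)t − 12x_c·(x_a x_b x_c)t − 8·(x_a x_c³)t`
(the expansion of `(x_b² − x_a x_b − 2x_a x_c)³`, every monomial factored through two
generators of `I₆`). [folklore] -/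
theorem eq_of_coe_eq_monomial_hPrime_cube (H : reesAlgebra I)
    (hH : (H : R[X]) = monomial 2 ((xb ^ 2 - xa * xb - 2 * (xa * xc)) ^ 3)) :
    H = reesT (xb ^ 3) h4 * (reesT (xb ^ 3) h4 + (-3 : R) • reesT (xa * xb ^ 2) h1 +
        (-6 : R) • reesT (xa * xb * xc) h2 + (3 * xb + 12 * xc) • reesT (xa ^ 2) h0) +
      reesT (xa ^ 2) h0 * ((12 : R) • reesT (xb ^ 2 * xc ^ 2) h5 +
        (-xb - 6 * xc) • reesT (xa * xb ^ 2) h1 + (-12 * xc) • reesT (xa * xb * xc) h2 +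
        (-8 : R) • reesT (xa * xc ^ 3) h3) := by
  apply Subtype.ext
  rw [hH]
  simp only [Subalgebra.coe_add, Subalgebra.coe_mul, Subalgebra.coe_smul, coe_reesT,
    Polynomial.smul_monomial, smul_eq_mul, mul_add, Polynomial.monomial_mul_monomial,
    Nat.reduceAdd]
  apply Polynomial.ext
  intro m
  simp only [Polynomial.coeff_add, Polynomial.coeff_monomial]
  split_ifs
  · ring
  · ring

include h0 in
/-- **HC₀W, algebraic core**: if `x_a x_b² t, x_a x_b x_c t, x_a x_c³ t, x_b³ t, x_b²x_c² t ∈ 𝔭`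
then `H′³ t² ∈ 𝔭`. [folklore] -/
theorem mem_of_coe_eq_monomial_hPrime_cube (H : reesAlgebra I)
    (hH : (H : R[X]) = monomial 2 ((xb ^ 2 - xa * xb - 2 * (xa * xc)) ^ 3))
    (𝔭 : Ideal (reesAlgebra I)) (k1 : reesT (xa * xb ^ 2) h1 ∈ 𝔭)
    (k2 : reesT (xa * xb * xc) h2 ∈ 𝔭) (k3 : reesT (xa * xc ^ 3) h3 ∈ 𝔭)
    (k4 : reesT (xb ^ 3) h4 ∈ 𝔭) (k5 : reesT (xb ^ 2 * xc ^ 2) h5 ∈ 𝔭) : H ∈ 𝔭 := by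
  rw [eq_of_coe_eq_monomial_hPrime_cube xa xb xc h0 h1 h2 h3 h4 h5 H hH]
  refine 𝔭.add_mem (𝔭.mul_mem_right _ k4) (𝔭.mul_mem_left _ ?_)
  exact 𝔭.add_mem (𝔭.add_mem (𝔭.add_mem (𝔭.smul_of_tower_mem _ k5)
    (𝔭.smul_of_tower_mem _ k1)) (𝔭.smul_of_tower_mem _ k2)) (𝔭.smul_of_tower_mem _ k3)

/-- **HC₁W, algebraic core (i)**: if `x_a² t, x_a x_b x_c t ∈ 𝔭` and `x_b³ t ∉ 𝔭`, then
`T′ t ∉ 𝔭`. [folklore] -/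
theorem reesT_not_mem_of_eq_tPrime (T : R)
    (hTdef : T = xb ^ 3 - 3 * (xa * xb * xc) + 3 * (xa ^ 2 * xd) - xa ^ 2 * xb) (hT : T ∈ I)
    (𝔭 : Ideal (reesAlgebra I)) (k0 : reesT (xa ^ 2) h0 ∈ 𝔭) (k2 : reesT (xa * xb * xc) h2 ∈ 𝔭)
    (k4 : reesT (xb ^ 3) h4 ∉ 𝔭) : reesT T hT ∉ 𝔭 := by
  intro hmem
  rw [reesT_eq_of_eq_tPrime xa xb xc xd h0 h2 h4 T hTdef hT, add_assoc] at hmem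
  exact k4 ((𝔭.add_mem_iff_left (𝔭.add_mem (𝔭.smul_of_tower_mem _ k2)
    (𝔭.smul_of_tower_mem _ k0))).mp hmem)

include h3 h5 in
/-- **HC₁W, algebraic core (ii)**: if `x_a² t, x_a x_b² t, x_a x_b x_c t ∈ 𝔭`, `𝔭` is prime and
`x_b³ t ∉ 𝔭`, then `H′³ t² ∉ 𝔭` (`H′³t² ≡ (x_b³t)·(x_b³t + 𝔭) mod x_a²t`). [folklore] -/
theorem not_mem_of_coe_eq_monomial_hPrime_cube (H : reesAlgebra I)
    (hH : (H : R[X]) = monomial 2 ((xb ^ 2 - xa * xb - 2 * (xa * xc)) ^ 3))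
    (𝔭 : Ideal (reesAlgebra I)) (h𝔭 : 𝔭.IsPrime) (k0 : reesT (xa ^ 2) h0 ∈ 𝔭)
    (k1 : reesT (xa * xb ^ 2) h1 ∈ 𝔭) (k2 : reesT (xa * xb * xc) h2 ∈ 𝔭)
    (k4 : reesT (xb ^ 3) h4 ∉ 𝔭) : H ∉ 𝔭 := by
  intro hmem
  rw [eq_of_coe_eq_monomial_hPrime_cube xa xb xc h0 h1 h2 h3 h4 h5 H hH] at hmem
  have hB : reesT (xa ^ 2) h0 * ((12 : R) • reesT (xb ^ 2 * xc ^ 2) h5 +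
      (-xb - 6 * xc) • reesT (xa * xb ^ 2) h1 + (-12 * xc) • reesT (xa * xb * xc) h2 +
      (-8 : R) • reesT (xa * xc ^ 3) h3) ∈ 𝔭 := 𝔭.mul_mem_right _ k0
  rcases h𝔭.mem_or_mem ((𝔭.add_mem_iff_left hB).mp hmem) with h | h
  · exact k4 h
  · rw [add_assoc, add_assoc] at h
    exact k4 ((𝔭.add_mem_iff_left (𝔭.add_mem (𝔭.smul_of_tower_mem _ k1)
      (𝔭.add_mem (𝔭.smul_of_tower_mem _ k2) (𝔭.smul_of_tower_mem _ k0)))).mp h)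

end ReesCores

/-! ### The specific ideal `I₆` and the chart `W_T` -/

variable (k : Type) [Field k] (n : ℕ) (a b c d : Fin n)

/-- The generator vector of `I₆` (lead-1's literal). -/
local notation3 "G6" => (![X a ^ (2 : ℕ), X a * X b ^ (2 : ℕ), X a * X b * X c,
    X a * X c ^ (3 : ℕ), X b ^ (3 : ℕ), X b ^ (2 : ℕ) * X c ^ (2 : ℕ), X b * X c ^ (4 : ℕ),
    X c ^ (6 : ℕ)] : Fin 8 → MvPolynomial (Fin n) k)

/-! ### Point-level: generator charts and the homogeneous prime of a point -/

/-- **Off the chart `Bl[⊤, x]`, `x t` lies in the homogeneous prime**: for `x ∈ I₆` and a point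
`v ∉ Bl[⊤, x]` of `Bl_{I₆} 𝔸ⁿ`, `x t ∈ 𝔭_v` (`D₊(x t) ⊆ Bl[⊤, x]`,
`BlowupExit.affineBlowup_chartOpen_le_blowupChart`). [folklore] -/
theorem reesT_mem_of_not_mem_blowupChart (x : MvPolynomial (Fin n) k)
    (hx : x ∈ Ideal.span (Set.range G6)) (v : affineBlowup (Ideal.span (Set.range G6)))
    (hv : v ∉ blowupChart (affineBlowup.π (Ideal.span (Set.range G6)))
      (affineBlowup.idealSheaf (Ideal.span (Set.range G6))) ⟨⊤, isAffineOpen_top _⟩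
      ((Scheme.ΓSpecIso (CommRingCat.of (MvPolynomial (Fin n) k))).inv.hom x)) :
    reesT x hx ∈ v.asHomogeneousIdeal := by
  by_contra h
  apply hv
  have hv' : v ∈ Proj.basicOpen (reesGrading (Ideal.span (Set.range G6))) (reesT x hx) :=
    (Proj.mem_basicOpen _ _ _).mpr h
  rw [← affineBlowup.image_top_chartι] at hv'
  exact SetLike.le_def.mp (BlowupExit.affineBlowup_chartOpen_le_blowupChart x hx) hv'

/-- **On the chart `D₊(x t)`, `x t ∉ 𝔭_v`.** [folklore] -/
theorem reesT_not_mem_of_mem_basicOpen (x : MvPolynomial (Fin n) k)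
    (hx : x ∈ Ideal.span (Set.range G6)) (v : affineBlowup (Ideal.span (Set.range G6)))
    (hv : v ∈ Proj.basicOpen (reesGrading (Ideal.span (Set.range G6))) (reesT x hx)) :
    reesT x hx ∉ v.asHomogeneousIdeal :=
  (Proj.mem_basicOpen _ _ _).mp hv

/-! ### The bricks -/

/-- **Brick `HC₀W` of the J₄ toric exit** (hypothesis `HC₀W` of
`JordanFour.jordanFour_hasResolution_of_bricks`, p501160, with `W := chartW`): the `μ₃`-vertex
curve `C₀ = π⁻¹V(x_a, x_b, x_c) ∖ ⋃_{j ≠ 0} Bl[⊤, g_j]` misses the twisted chart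
`W_T = D₊(T′t) ⊓ D₊(H′³t²)` — off the charts `j ≠ 0` every `g_j t` (`j ≠ 0`) lies in `𝔭_v`,
hence so does `H′³t²` (`mem_of_coe_eq_monomial_hPrime_cube`). [OURS · L1 W4.5c] [folklore] -/
theorem disjoint_curveZero_chartW :
    Disjoint
      ({v | (affineBlowup.π (Ideal.span (Set.range G6))).base v ∈
          PrimeSpectrum.zeroLocus ({X a, X b, X c} : Set (MvPolynomial (Fin n) k))} \
        ((⨆ j : {j : Fin 8 // j ≠ 0}, blowupChart
          (affineBlowup.π (Ideal.span (Set.range G6)))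
          (affineBlowup.idealSheaf (Ideal.span (Set.range G6)))
          ⟨⊤, isAffineOpen_top _⟩
          ((Scheme.ΓSpecIso (CommRingCat.of (MvPolynomial (Fin n) k))).inv.hom (G6 j.1)) :
          (affineBlowup (Ideal.span (Set.range G6))).Opens) : Set _))
      (chartW k n a b c d : Set _) := by
  rw [Set.disjoint_left]
  rintro v ⟨-, hv⟩ hvW
  -- `g_j t ∈ 𝔭_v` for `j ≠ 0`
  have hmem : ∀ j : Fin 8, j ≠ 0 →
      reesT (G6 j) (Ideal.mem_span_range_self (f := G6) (x := j)) ∈ v.asHomogeneousIdeal := by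
    intro j hj
    refine reesT_mem_of_not_mem_blowupChart k n a b c (G6 j) _ v fun h => hv ?_
    exact Opens.mem_iSup.mpr ⟨⟨j, hj⟩, h⟩
  have hH : hCubeT2 k n a b c ∈ v.asHomogeneousIdeal.toIdeal :=
    mem_of_coe_eq_monomial_hPrime_cube (X a) (X b) (X c)
      (Ideal.mem_span_range_self (f := G6) (x := 0)) (Ideal.mem_span_range_self (f := G6) (x := 1))
      (Ideal.mem_span_range_self (f := G6) (x := 2)) (Ideal.mem_span_range_self (f := G6) (x := 3))
      (Ideal.mem_span_range_self (f := G6) (x := 4)) (Ideal.mem_span_range_self (f := G6) (x := 5))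
      (hCubeT2 k n a b c) rfl v.asHomogeneousIdeal.toIdeal
      (hmem 1 (by decide)) (hmem 2 (by decide)) (hmem 3 (by decide)) (hmem 4 (by decide))
      (hmem 5 (by decide))
  have hvW' : v ∈ Proj.basicOpen (reesGrading (Ideal.span (Set.range G6)))
      (reesT (tPrime k n a b c d) (tPrime_mem_I6 k n a b c d) * hCubeT2 k n a b c) := hvW
  exact (Proj.mem_basicOpen _ _ _).mp hvW' (v.asHomogeneousIdeal.toIdeal.mul_mem_left _ hH)

/-- **Brick `HC₁W` of the J₄ toric exit** (hypothesis `HC₁W` of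
`JordanFour.jordanFour_hasResolution_of_bricks`, p501160, with `W := chartW`): the `μ₂`-vertex
curve `C₁ = π⁻¹V(x_a, x_b, x_c) ∖ ⋃_{j ≠ 4} Bl[⊤, g_j]` lies in the twisted chart
`W_T = D₊(T′t) ⊓ D₊(H′³t²)` — off the charts `j ≠ 4` every `g_j t` (`j ≠ 4`) lies in `𝔭_v`, so
`x_b³ t ∉ 𝔭_v` (the `D₊(g_j t)` cover), and then `T′t ≡ x_b³t`, `H′³t² ≡ (x_b³t)²` are not in
`𝔭_v`. [OURS · L1 W4.5c] [folklore] -/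
theorem curveOne_subset_chartW :
    {v | (affineBlowup.π (Ideal.span (Set.range G6))).base v ∈
          PrimeSpectrum.zeroLocus ({X a, X b, X c} : Set (MvPolynomial (Fin n) k))} \
        ((⨆ j : {j : Fin 8 // j ≠ 4}, blowupChart
          (affineBlowup.π (Ideal.span (Set.range G6)))
          (affineBlowup.idealSheaf (Ideal.span (Set.range G6)))
          ⟨⊤, isAffineOpen_top _⟩
          ((Scheme.ΓSpecIso (CommRingCat.of (MvPolynomial (Fin n) k))).inv.hom (G6 j.1)) :
          (affineBlowup (Ideal.span (Set.range G6))).Opens) : Set _) ⊆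
      (chartW k n a b c d : Set _) := by
  rintro v ⟨-, hv⟩
  -- `g_j t ∈ 𝔭_v` for `j ≠ 4`
  have hmem : ∀ j : Fin 8, j ≠ 4 →
      reesT (G6 j) (Ideal.mem_span_range_self (f := G6) (x := j)) ∈ v.asHomogeneousIdeal := by
    intro j hj
    refine reesT_mem_of_not_mem_blowupChart k n a b c (G6 j) _ v fun h => hv ?_
    exact Opens.mem_iSup.mpr ⟨⟨j, hj⟩, h⟩
  -- the generator charts cover, so `x_b³ t ∉ 𝔭_v`
  have h4 : reesT (G6 4) (Ideal.mem_span_range_self (f := G6) (x := 4)) ∉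
      v.asHomogeneousIdeal := by
    have hcov : v ∈ (⨆ i : Fin 8, Proj.basicOpen (reesGrading (Ideal.span (Set.range G6)))
        (reesT (G6 i) (Ideal.mem_span_range_self (f := G6) (x := i)))) := by
      rw [affineBlowup.iSup_basicOpen_reesT_generators_eq_top]; trivial
    obtain ⟨i, hi⟩ := Opens.mem_iSup.mp hcov
    by_cases hi4 : i = 4
    · subst hi4
      exact (Proj.mem_basicOpen _ _ _).mp hi
    · exact absurd (hmem i hi4) ((Proj.mem_basicOpen _ _ _).mp hi)
  have hT : reesT (tPrime k n a b c d) (tPrime_mem_I6 k n a b c d) ∉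
      v.asHomogeneousIdeal.toIdeal :=
    reesT_not_mem_of_eq_tPrime (X a) (X b) (X c) (X d)
      (Ideal.mem_span_range_self (f := G6) (x := 0)) (Ideal.mem_span_range_self (f := G6) (x := 2))
      (Ideal.mem_span_range_self (f := G6) (x := 4)) (tPrime k n a b c d) rfl
      (tPrime_mem_I6 k n a b c d) v.asHomogeneousIdeal.toIdeal
      (hmem 0 (by decide)) (hmem 2 (by decide)) h4
  have hH : hCubeT2 k n a b c ∉ v.asHomogeneousIdeal.toIdeal :=
    not_mem_of_coe_eq_monomial_hPrime_cube (X a) (X b) (X c)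
      (Ideal.mem_span_range_self (f := G6) (x := 0)) (Ideal.mem_span_range_self (f := G6) (x := 1))
      (Ideal.mem_span_range_self (f := G6) (x := 2)) (Ideal.mem_span_range_self (f := G6) (x := 3))
      (Ideal.mem_span_range_self (f := G6) (x := 4)) (Ideal.mem_span_range_self (f := G6) (x := 5))
      (hCubeT2 k n a b c) rfl v.asHomogeneousIdeal.toIdeal v.isPrime
      (hmem 0 (by decide)) (hmem 1 (by decide)) (hmem 2 (by decide)) h4
  show v ∈ Proj.basicOpen (reesGrading (Ideal.span (Set.range G6)))
      (reesT (tPrime k n a b c d) (tPrime_mem_I6 k n a b c d) * hCubeT2 k n a b c)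
  exact (Proj.mem_basicOpen _ _ _).mpr fun h => (v.isPrime.mem_or_mem h).elim hT hH

end Summit.ResolutionOfSingularities.ResolutionOfSingularities.Theorems.WildQuotientResolution.JordanFour

end
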